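import Literature.FieldTheory.RealClosed.FiniteExtension
import Mathlib.Algebra.Polynomial.Derivative
import Mathlib.Algebra.Polynomial.FieldDivision
import Mathlib.Algebra.Polynomial.RingDivision
import Mathlib.RingTheory.Polynomial.UniqueFactorization
import Mathlib.Data.Sign.Basic
import Mathlib.Order.Interval.Set.Basic
import HarnessLib

/-!
# Univariate polynomials over a real closed field: the intermediate value property, Rolle's
# theorem, monotonicity, signs at infinity

Let `K` be a real closed field (`IsRealClosed K` with its order). Using that irreducible
polynomials over `K` have degree `≤ 2` (`Literature.FieldTheory.RealClosed.natDegree_le_two_of_irreducible`)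
we prove the elementary "calculus" of polynomial functions `K → K` that over `ℝ` one takes from
analysis (Basu–Pollack–Roy 2006, §2.1–2.2):

* `exists_root_of_eval_mul_eval_neg`: the **intermediate value property** for polynomials
  (Thm. 2.11 `b) ⇒ c)`): a sign change on `[a, b]` forces a root in `(a, b)`; variants
  `exists_root_of_neg_of_pos`, `exists_root_of_pos_of_neg`, and sign constancy on root-free
  intervals `sign_eq_sign_of_forall_ne_zero` (Prop. 2.20);
* `exists_root_derivative_of_eval_eq_zero`: **Rolle's theorem** (Prop. 2.22);
* `strictMonoOn_of_derivative_pos`, `strictMonoOn_or_strictAntiOn`: monotonicity from the sign of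
  the derivative (Cor. 2.24, via the mean value theorem argument of Cor. 2.23);
* `exists_forall_le_sign_eval_eq`, `exists_forall_ge_sign_eval_eq`: the sign of `P(x)` for `x`
  large (resp. small) is the sign of the leading coefficient (resp. times `(-1) ^ deg P`)
  (Prop. 2.4 / the discussion after Prop. 2.20).

## References

* S. Basu, R. Pollack, M.-F. Roy, *Algorithms in Real Algebraic Geometry*, 2nd ed. (2006),
  Thm. 2.11, Prop. 2.20, Prop. 2.22, Cor. 2.23, Cor. 2.24.
* J. Bochnak, M. Coste, M.-F. Roy, *Real Algebraic Geometry* (1998), §1.2.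
-/

noncomputable section

open Polynomial Set

namespace Literature.FieldTheory.RealClosed

variable {K : Type*} [Field K] [LinearOrder K] [IsStrictOrderedRing K]

/-! ### Linear and quadratic polynomials (ordered fields) -/

/-- A polynomial of degree `1` which changes sign on `[a, b]` has a root in `(a, b)` (explicit
root `-c₀ / c₁`). [folklore] -/
theorem exists_root_of_natDegree_eq_one {p : K[X]} (hp : p.natDegree = 1) {a b : K} (hab : a < b)
    (h : p.eval a * p.eval b < 0) : ∃ r ∈ Ioo a b, p.eval r = 0 := by
  have hp1 : p = C (p.coeff 1) * X + C (p.coeff 0) := eq_X_add_C_of_natDegree_le_one hp.le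
  have hc : p.coeff 1 ≠ 0 := by
    have : p.leadingCoeff ≠ 0 := leadingCoeff_ne_zero.mpr (ne_zero_of_natDegree_gt (hp ▸ one_pos))
    rwa [leadingCoeff, hp] at this
  set c := p.coeff 1 with hcdef
  set d := p.coeff 0 with hddef
  have hev : ∀ x, p.eval x = c * (x - (-d / c)) := by
    intro x; conv_lhs => rw [hp1]
    simp only [eval_add, eval_mul, eval_C, eval_X]
    field_simp
    ring
  refine ⟨-d / c, ?_, by rw [hev]; ring⟩
  rw [hev, hev] at h
  have h' : (a - -d / c) * (b - -d / c) < 0 := by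
    have hcc : 0 < c * c := mul_self_pos.mpr hc
    by_contra hge
    push Not at hge
    have : 0 ≤ c * (a - -d / c) * (c * (b - -d / c)) := by
      have : c * (a - -d / c) * (c * (b - -d / c)) = (c * c) * ((a - -d / c) * (b - -d / c)) := by
        ring
      rw [this]; exact mul_nonneg hcc.le hge
    linarith
  rcases mul_neg_iff.mp h' with ⟨h1, h2⟩ | ⟨h1, h2⟩
  · exact absurd ((sub_neg.mp h2).trans (sub_pos.mp h1)) (lt_asymm hab)
  · exact ⟨sub_neg.mp h1, sub_pos.mp h2⟩

variable [IsRealClosed K]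

/-- Over a real closed field, an irreducible polynomial of degree `2` takes values of one strict
sign: its discriminant is negative, since a nonnegative discriminant has a square root and yields a
root (Basu–Pollack–Roy 2006, Exercise 2.9 and Prop. 2.19). [cite: BasuPollackRoy2006, Prop. 2.19] -/
theorem eval_mul_eval_pos_of_irreducible_of_natDegree_eq_two {p : K[X]} (hirr : Irreducible p)
    (hp : p.natDegree = 2) (a b : K) : 0 < p.eval a * p.eval b := by
  set c := p.coeff 2 with hcdef
  set d := p.coeff 1 with hddef
  set e := p.coeff 0 with hedef
  have hc : c ≠ 0 := by
    have : p.leadingCoeff ≠ 0 := leadingCoeff_ne_zero.mpr hirr.ne_zero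
    rwa [leadingCoeff, hp] at this
  have hev : ∀ x, p.eval x = c * x ^ 2 + d * x + e := by
    intro x
    rw [eval_eq_sum_range, hp]
    simp [Finset.sum_range_succ]
    ring
  -- the discriminant is negative
  have hdisc : d * d - 4 * c * e < 0 := by
    by_contra hge
    push Not at hge
    obtain ⟨s, -, hs⟩ := exists_nonneg_mul_self_eq hge
    -- then `(-d + s) / (2 c)` is a root, contradicting irreducibility in degree 2
    have hroot : p.IsRoot ((-d + s) / (2 * c)) := by
      rw [IsRoot.def, hev]
      field_simp
      linear_combination hs
    have h1 := degree_eq_one_of_irreducible_of_root hirr hroot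
    rw [degree_eq_natDegree hirr.ne_zero, hp] at h1
    exact absurd h1 (by decide)
  -- `4 c p(x) = (2 c x + d)² - disc > 0`
  have hpos : ∀ x, 0 < c * p.eval x := by
    intro x
    rw [hev]
    nlinarith [sq_nonneg (2 * c * x + d), mul_self_pos.mpr hc]
  have := mul_pos (hpos a) (hpos b)
  have hcc : 0 < c * c := mul_self_pos.mpr hc
  have heq : c * p.eval a * (c * p.eval b) = (c * c) * (p.eval a * p.eval b) := by ring
  rw [heq] at this
  exact pos_of_mul_pos_right this hcc.le

/-! ### The intermediate value property -/

/-- **Intermediate value property for polynomials over a real closed field**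
(Basu–Pollack–Roy 2006, Thm. 2.11 `a) ⇒ c)`; Bochnak–Coste–Roy 1998, Prop. 1.2.4): if
`P(a) P(b) < 0` with `a < b` then `P` has a root in `(a, b)`. Proof: induction along a
factorization into irreducibles; a sign change of a product is a sign change of a factor, an
irreducible factor which changes sign has degree `1` (degree `≤ 2` always, and irreducible
quadratics have constant sign). [cite: BasuPollackRoy2006, Thm. 2.11] -/
theorem exists_root_of_eval_mul_eval_neg {p : K[X]} {a b : K} (hab : a < b)
    (h : p.eval a * p.eval b < 0) : ∃ r ∈ Ioo a b, p.eval r = 0 := by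
  induction p using WfDvdMonoid.induction_on_irreducible with
  | zero => simp at h
  | unit u hu =>
    obtain ⟨c, -, rfl⟩ := Polynomial.isUnit_iff.mp hu
    simp only [eval_C] at h
    exact absurd h (not_lt.mpr (mul_self_nonneg c))
  | mul q i hq hi ih =>
    simp only [eval_mul] at h ⊢
    have h' : (i.eval a * i.eval b) * (q.eval a * q.eval b) < 0 := by
      have : i.eval a * q.eval a * (i.eval b * q.eval b) =
          (i.eval a * i.eval b) * (q.eval a * q.eval b) := by ring
      rwa [this] at h
    rcases mul_neg_iff.mp h' with ⟨-, hq'⟩ | ⟨hi', -⟩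
    · obtain ⟨r, hr, hr0⟩ := ih hq'
      exact ⟨r, hr, by rw [hr0, mul_zero]⟩
    · -- the irreducible factor changes sign: it has degree `1`
      have hle := natDegree_le_two_of_irreducible hi
      have hpos : 0 < i.natDegree := natDegree_pos_iff_degree_pos.mpr (degree_pos_of_irreducible hi)
      have hdeg : i.natDegree = 1 := by
        rcases Nat.lt_or_ge i.natDegree 2 with hlt | hge
        · omega
        · have h2 : i.natDegree = 2 := le_antisymm hle hge
          exact absurd hi' (not_lt.mpr
            (eval_mul_eval_pos_of_irreducible_of_natDegree_eq_two hi h2 a b).le)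
      obtain ⟨r, hr, hr0⟩ := exists_root_of_natDegree_eq_one hdeg hab hi'
      exact ⟨r, hr, by rw [hr0, zero_mul]⟩

/-- IVT for polynomials over a real closed field, increasing version
(Basu–Pollack–Roy 2006, Thm. 2.11). [cite: BasuPollackRoy2006, Thm. 2.11] -/
theorem exists_root_of_neg_of_pos {p : K[X]} {a b : K} (hab : a ≤ b) (ha : p.eval a < 0)
    (hb : 0 < p.eval b) : ∃ r ∈ Ioo a b, p.eval r = 0 := by
  rcases eq_or_lt_of_le hab with rfl | hab'
  · exact absurd (ha.trans hb) (lt_irrefl _)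
  · exact exists_root_of_eval_mul_eval_neg hab' (mul_neg_of_neg_of_pos ha hb)

/-- IVT for polynomials over a real closed field, decreasing version
(Basu–Pollack–Roy 2006, Thm. 2.11). [cite: BasuPollackRoy2006, Thm. 2.11] -/
theorem exists_root_of_pos_of_neg {p : K[X]} {a b : K} (hab : a ≤ b) (ha : 0 < p.eval a)
    (hb : p.eval b < 0) : ∃ r ∈ Ioo a b, p.eval r = 0 := by
  rcases eq_or_lt_of_le hab with rfl | hab'
  · exact absurd (hb.trans ha) (lt_irrefl _)
  · exact exists_root_of_eval_mul_eval_neg hab' (mul_neg_of_pos_of_neg ha hb)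

/-- **Sign constancy** (Basu–Pollack–Roy 2006, Prop. 2.20): a polynomial which does not vanish on
`[a, b]` has the same sign at `a` and `b`. [cite: BasuPollackRoy2006, Prop. 2.20] -/
theorem sign_eq_sign_of_forall_ne_zero {p : K[X]} {a b : K} (hab : a ≤ b)
    (h : ∀ z ∈ Icc a b, p.eval z ≠ 0) :
    SignType.sign (p.eval a) = SignType.sign (p.eval b) := by
  have ha : p.eval a ≠ 0 := h a (left_mem_Icc.mpr hab)
  have hb : p.eval b ≠ 0 := h b (right_mem_Icc.mpr hab)
  rcases lt_or_gt_of_ne ha with ha' | ha' <;> rcases lt_or_gt_of_ne hb with hb' | hb'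
  · rw [sign_neg ha', sign_neg hb']
  · obtain ⟨r, hr, hr0⟩ := exists_root_of_neg_of_pos hab ha' hb'
    exact absurd hr0 (h r (Ioo_subset_Icc_self hr))
  · obtain ⟨r, hr, hr0⟩ := exists_root_of_pos_of_neg hab ha' hb'
    exact absurd hr0 (h r (Ioo_subset_Icc_self hr))
  · rw [sign_pos ha', sign_pos hb']

/-! ### Rolle's theorem and monotonicity -/

/-- Rolle's theorem between two *consecutive* roots (Basu–Pollack–Roy 2006, proof of Prop. 2.22):
write `P = (X - a)^m (X - b)^n Q` with `Q` without roots on `[a, b]`; then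
`P' = (X - a)^(m-1) (X - b)^(n-1) Q₁` with `Q₁ = m (X - b) Q + n (X - a) Q + (X - a)(X - b) Q'`,
and `Q₁(a) = m (a - b) Q(a)`, `Q₁(b) = n (b - a) Q(b)` have opposite signs.
[cite: BasuPollackRoy2006, Prop. 2.22] -/
theorem exists_root_derivative_of_forall_ne_zero {p : K[X]} (hp : p ≠ 0) {a b : K} (hab : a < b)
    (ha : p.eval a = 0) (hb : p.eval b = 0) (hno : ∀ z ∈ Ioo a b, p.eval z ≠ 0) :
    ∃ c ∈ Ioo a b, p.derivative.eval c = 0 := by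
  -- factor out the root `a`
  obtain ⟨p₁, hp₁, hdvd₁⟩ := exists_eq_pow_rootMultiplicity_mul_and_not_dvd p hp a
  obtain ⟨m', hm'⟩ : ∃ m', p.rootMultiplicity a = m' + 1 :=
    ⟨_, (Nat.succ_pred_eq_of_pos ((rootMultiplicity_pos hp).mpr ha)).symm⟩
  rw [hm'] at hp₁
  have hp₁a : p₁.eval a ≠ 0 := fun h0 => hdvd₁ (dvd_iff_isRoot.mpr h0)
  have hp₁0 : p₁ ≠ 0 := fun h0 => hp₁a (by rw [h0, eval_zero])
  have hp₁b : p₁.eval b = 0 := by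
    have h1 : p.eval b = (b - a) ^ (m' + 1) * p₁.eval b := by
      conv_lhs => rw [hp₁]
      simp [eval_mul, eval_pow]
    rw [hb] at h1
    exact (mul_eq_zero.mp h1.symm).resolve_left (pow_ne_zero _ (sub_ne_zero.mpr hab.ne'))
  -- factor out the root `b`
  obtain ⟨q, hq, hdvd₂⟩ := exists_eq_pow_rootMultiplicity_mul_and_not_dvd p₁ hp₁0 b
  obtain ⟨n', hn'⟩ : ∃ n', p₁.rootMultiplicity b = n' + 1 :=
    ⟨_, (Nat.succ_pred_eq_of_pos ((rootMultiplicity_pos hp₁0).mpr hp₁b)).symm⟩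
  rw [hn'] at hq
  have hqb : q.eval b ≠ 0 := fun h0 => hdvd₂ (dvd_iff_isRoot.mpr h0)
  have hqa : q.eval a ≠ 0 := by
    intro h0
    apply hp₁a
    rw [hq]; simp [eval_mul, h0]
  -- `q` has no root on `[a, b]`, hence constant sign
  have hpq : p = (X - C a) ^ (m' + 1) * (X - C b) ^ (n' + 1) * q := by rw [hp₁, hq, mul_assoc]
  have hqI : ∀ z ∈ Icc a b, q.eval z ≠ 0 := by
    intro z hz h0
    rcases eq_or_lt_of_le hz.1 with rfl | haz
    · exact hqa h0
    rcases eq_or_lt_of_le hz.2 with rfl | hzb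
    · exact hqb h0
    refine hno z ⟨haz, hzb⟩ ?_
    rw [hpq]; simp [eval_mul, h0]
  have hsq : SignType.sign (q.eval a) = SignType.sign (q.eval b) :=
    sign_eq_sign_of_forall_ne_zero hab.le hqI
  -- the cofactor `Q₁` of `P'`
  set Q₁ : K[X] := C ((m' + 1 : ℕ) : K) * (X - C b) * q + C ((n' + 1 : ℕ) : K) * (X - C a) * q +
    (X - C a) * (X - C b) * derivative q with hQ₁
  have hder : derivative p = (X - C a) ^ m' * (X - C b) ^ n' * Q₁ := by
    rw [hpq, hQ₁]
    simp only [derivative_mul, derivative_pow, derivative_sub, derivative_X, derivative_C,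
      sub_zero, mul_one, Nat.add_sub_cancel]
    ring
  have hQa : Q₁.eval a = ((m' + 1 : ℕ) : K) * (a - b) * q.eval a := by
    rw [hQ₁]; simp [eval_mul]
  have hQb : Q₁.eval b = ((n' + 1 : ℕ) : K) * (b - a) * q.eval b := by
    rw [hQ₁]; simp [eval_mul]
  -- `Q₁(a)` and `Q₁(b)` have opposite signs
  have hm1 : (0 : K) < ((m' + 1 : ℕ) : K) := by positivity
  have hn1 : (0 : K) < ((n' + 1 : ℕ) : K) := by positivity
  have hab' : 0 < b - a := sub_pos.mpr hab
  have hneg : Q₁.eval a * Q₁.eval b < 0 := by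
    rw [hQa, hQb]
    have hqq : 0 < q.eval a * q.eval b := by
      rcases lt_or_gt_of_ne hqa with h1 | h1
      · rw [sign_neg h1] at hsq
        exact mul_pos_of_neg_of_neg h1 (sign_eq_neg_one_iff.mp hsq.symm)
      · rw [sign_pos h1] at hsq
        exact mul_pos h1 (sign_eq_one_iff.mp hsq.symm)
    have : ((m' + 1 : ℕ) : K) * (a - b) * q.eval a * (((n' + 1 : ℕ) : K) * (b - a) * q.eval b) =
        -((((m' + 1 : ℕ) : K) * ((n' + 1 : ℕ) : K)) * ((b - a) * (b - a)) *
          (q.eval a * q.eval b)) := by ring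
    rw [this, neg_lt_zero]
    positivity
  obtain ⟨c, hc, hc0⟩ := exists_root_of_eval_mul_eval_neg hab hneg
  exact ⟨c, hc, by rw [hder, eval_mul, hc0, mul_zero]⟩

/-- **Rolle's theorem for polynomials over a real closed field** (Basu–Pollack–Roy 2006,
Prop. 2.22): if `P ≠ 0` vanishes at `a < b` then `P'` has a root in `(a, b)`. Reduced to
consecutive roots by replacing `b` with the smallest root of `P` in `(a, b)`.
[cite: BasuPollackRoy2006, Prop. 2.22] -/
theorem exists_root_derivative_of_eval_eq_zero {p : K[X]} (hp : p ≠ 0) {a b : K} (hab : a < b)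
    (ha : p.eval a = 0) (hb : p.eval b = 0) : ∃ c ∈ Ioo a b, p.derivative.eval c = 0 := by
  classical
  set S : Finset K := p.roots.toFinset.filter fun z => a < z ∧ z < b with hS
  by_cases hne : S.Nonempty
  · set b' := S.min' hne with hb'
    have hb'S : b' ∈ S := Finset.min'_mem S hne
    rw [hS, Finset.mem_filter, Multiset.mem_toFinset, mem_roots hp] at hb'S
    obtain ⟨hroot, hab', hb'b⟩ := hb'S
    have hno : ∀ z ∈ Ioo a b', p.eval z ≠ 0 := by
      intro z hz h0
      have hzS : z ∈ S := by
        rw [hS, Finset.mem_filter, Multiset.mem_toFinset, mem_roots hp]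
        exact ⟨h0, hz.1, hz.2.trans hb'b⟩
      exact absurd (Finset.min'_le S z hzS) (not_le.mpr hz.2)
    obtain ⟨c, hc, hc0⟩ := exists_root_derivative_of_forall_ne_zero hp hab' ha hroot hno
    exact ⟨c, ⟨hc.1, hc.2.trans hb'b⟩, hc0⟩
  · refine exists_root_derivative_of_forall_ne_zero hp hab ha hb fun z hz h0 => hne ⟨z, ?_⟩
    rw [hS, Finset.mem_filter, Multiset.mem_toFinset, mem_roots hp]
    exact ⟨h0, hz.1, hz.2⟩

/-- **Monotonicity from the sign of the derivative** (Basu–Pollack–Roy 2006, Cor. 2.24, via the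
mean value theorem Cor. 2.23): if `P' > 0` on `(a, b)` then `P` is strictly increasing on
`[a, b]`. Proof: for `x < y` with `P(y) ≤ P(x)`, Rolle's theorem applied to
`P - P(x) - μ (X - x)`, `μ = (P(y) - P(x)) / (y - x) ≤ 0`, gives a point where `P' = μ ≤ 0`.
[cite: BasuPollackRoy2006, Cor. 2.24] -/
theorem strictMonoOn_of_derivative_pos {p : K[X]} {a b : K}
    (h : ∀ z ∈ Ioo a b, 0 < p.derivative.eval z) :
    StrictMonoOn (fun x => p.eval x) (Icc a b) := by
  intro x hx y hy hxy
  by_contra hle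
  push Not at hle
  set μ : K := (p.eval y - p.eval x) / (y - x) with hμ
  have hyx : 0 < y - x := sub_pos.mpr hxy
  have hμ0 : μ ≤ 0 := div_nonpos_of_nonpos_of_nonneg (sub_nonpos.mpr hle) hyx.le
  set g : K[X] := p - C (p.eval x) - C μ * (X - C x) with hg
  have hgx : g.eval x = 0 := by rw [hg]; simp
  have hgy : g.eval y = 0 := by
    rw [hg]; simp only [eval_sub, eval_mul, eval_C, eval_X, hμ]
    field_simp
    ring
  have hgd : derivative g = derivative p - C μ := by
    rw [hg]; simp only [derivative_sub, derivative_mul, derivative_C, derivative_X]; ring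
  have hsub : Ioo x y ⊆ Ioo a b := Ioo_subset_Ioo hx.1 hy.2
  have hg0 : g ≠ 0 := by
    intro h0
    have hz : (x + y) / 2 ∈ Ioo x y := ⟨by linarith, by linarith⟩
    have h1 := h _ (hsub hz)
    have h2 : (derivative g).eval ((x + y) / 2) = 0 := by rw [h0, derivative_zero, eval_zero]
    rw [hgd, eval_sub, eval_C] at h2
    linarith
  obtain ⟨c, hc, hc0⟩ := exists_root_derivative_of_eval_eq_zero hg0 hxy hgx hgy
  rw [hgd, eval_sub, eval_C] at hc0
  have := h c (hsub hc)
  linarith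

/-- If `P' < 0` on `(a, b)` then `P` is strictly decreasing on `[a, b]` (Basu–Pollack–Roy 2006,
Cor. 2.24). [cite: BasuPollackRoy2006, Cor. 2.24] -/
theorem strictAntiOn_of_derivative_neg {p : K[X]} {a b : K}
    (h : ∀ z ∈ Ioo a b, p.derivative.eval z < 0) :
    StrictAntiOn (fun x => p.eval x) (Icc a b) := by
  have h' : ∀ z ∈ Ioo a b, 0 < (-p).derivative.eval z := fun z hz => by
    rw [derivative_neg, eval_neg]; exact neg_pos.mpr (h z hz)
  have hm := strictMonoOn_of_derivative_pos h'
  intro x hx y hy hxy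
  have := hm hx hy hxy
  simp only [eval_neg, neg_lt_neg_iff] at this
  exact this

/-- A polynomial whose derivative does not vanish on `(a, b)` is strictly monotone or strictly
antitone on `[a, b]` (Basu–Pollack–Roy 2006, Cor. 2.24 with Prop. 2.20 for `P'`).
[cite: BasuPollackRoy2006, Cor. 2.24] -/
theorem strictMonoOn_or_strictAntiOn {p : K[X]} {a b : K} (hab : a < b)
    (h : ∀ z ∈ Ioo a b, p.derivative.eval z ≠ 0) :
    StrictMonoOn (fun x => p.eval x) (Icc a b) ∨ StrictAntiOn (fun x => p.eval x) (Icc a b) := by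
  -- the derivative has constant sign on `(a, b)`
  set m : K := (a + b) / 2 with hm
  have hmI : m ∈ Ioo a b := ⟨by rw [hm]; linarith, by rw [hm]; linarith⟩
  have hconst : ∀ z ∈ Ioo a b,
      SignType.sign (p.derivative.eval z) = SignType.sign (p.derivative.eval m) := by
    intro z hz
    rcases le_total z m with hzm | hmz
    · exact sign_eq_sign_of_forall_ne_zero hzm fun w hw =>
        h w ⟨hz.1.trans_le hw.1, hw.2.trans_lt hmI.2⟩
    · exact (sign_eq_sign_of_forall_ne_zero hmz fun w hw =>
        h w ⟨hmI.1.trans_le hw.1, hw.2.trans_lt hz.2⟩).symm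
  rcases lt_or_gt_of_ne (h m hmI) with hneg | hpos
  · right
    refine strictAntiOn_of_derivative_neg fun x hx => ?_
    have := hconst x hx
    rw [sign_neg hneg] at this
    exact sign_eq_neg_one_iff.mp this
  · left
    refine strictMonoOn_of_derivative_pos fun x hx => ?_
    have := hconst x hx
    rw [sign_pos hpos] at this
    exact sign_eq_one_iff.mp this

end Literature.FieldTheory.RealClosed

/-! ### Signs at infinity (ordered fields) -/

namespace Literature.FieldTheory.RealClosed

variable {K : Type*} [Field K] [LinearOrder K] [IsStrictOrderedRing K]

/-- **Sign at `+∞`** (Basu–Pollack–Roy 2006, Prop. 2.4 and the discussion after Prop. 2.20): a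
non-constant polynomial has the sign of its leading coefficient at every `x ≥ T`, for a suitable
`T` (e.g. `1 + Σ |aᵢ| / |aₙ|`). Valid over any linearly ordered field. [cite: BasuPollackRoy2006, Prop. 2.4] -/
theorem exists_forall_le_sign_eval_eq (p : K[X]) (hp : 0 < p.natDegree) :
    ∃ T : K, ∀ x, T ≤ x → SignType.sign (p.eval x) = SignType.sign p.leadingCoeff := by
  set n := p.natDegree with hn
  set c := p.leadingCoeff with hc
  have hc0 : c ≠ 0 := leadingCoeff_ne_zero.mpr (ne_zero_of_natDegree_gt hp)
  set S : K := ∑ i ∈ Finset.range n, |p.coeff i| with hS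
  have hS0 : 0 ≤ S := Finset.sum_nonneg fun i _ => abs_nonneg _
  refine ⟨max 1 (S / |c| + 1), fun x hx => ?_⟩
  have hx1 : 1 ≤ x := le_trans (le_max_left _ _) hx
  have hx0 : 0 < x := one_pos.trans_le hx1
  have hxS : S < |c| * x := by
    have h1 : S / |c| + 1 ≤ x := le_trans (le_max_right _ _) hx
    have hca : 0 < |c| := abs_pos.mpr hc0
    have : S / |c| < x := by linarith
    rwa [div_lt_iff₀ hca, mul_comm] at this
  -- `p(x) = c x^n + r(x)` with `|r(x)| ≤ S x^(n-1)`
  obtain ⟨k, hk⟩ : ∃ k, n = k + 1 := ⟨n - 1, by omega⟩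
  have hev : p.eval x = c * x ^ n + ∑ i ∈ Finset.range n, p.coeff i * x ^ i := by
    rw [eval_eq_sum_range, Finset.sum_range_succ, add_comm]
    rfl
  have hrest : |∑ i ∈ Finset.range n, p.coeff i * x ^ i| ≤ S * x ^ k := by
    refine (Finset.abs_sum_le_sum_abs _ _).trans ?_
    rw [hS, Finset.sum_mul]
    refine Finset.sum_le_sum fun i hi => ?_
    rw [abs_mul, abs_of_nonneg (pow_nonneg hx0.le i)]
    refine mul_le_mul_of_nonneg_left ?_ (abs_nonneg _)
    exact pow_le_pow_right₀ hx1 (by rw [Finset.mem_range] at hi; omega)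
  have hxk : 0 < x ^ k := pow_pos hx0 k
  have hmain : S * x ^ k < |c| * x ^ n := by
    rw [hk, pow_succ]
    calc S * x ^ k < |c| * x * x ^ k := mul_lt_mul_of_pos_right hxS hxk
      _ = |c| * (x ^ k * x) := by ring
  have habs := abs_le.mp hrest
  rcases lt_or_gt_of_ne hc0 with hneg | hpos
  · rw [sign_neg hneg, sign_neg]
    rw [hev]
    rw [abs_of_neg hneg] at hmain
    nlinarith [habs.2]
  · rw [sign_pos hpos, sign_pos]
    rw [hev]
    rw [abs_of_pos hpos] at hmain
    nlinarith [habs.1]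

/-- **Sign at `-∞`**: a non-constant polynomial has the sign `(-1) ^ deg P · sign (lc P)` at every
`x ≤ T`, for a suitable `T` (Basu–Pollack–Roy 2006, discussion after Prop. 2.20; from the `+∞`
case applied to `P(-X)`). [cite: BasuPollackRoy2006, Prop. 2.4] -/
theorem exists_forall_ge_sign_eval_eq (p : K[X]) (hp : 0 < p.natDegree) :
    ∃ T : K, ∀ x, x ≤ T → SignType.sign (p.eval x) =
      (if Even p.natDegree then SignType.sign p.leadingCoeff
        else -SignType.sign p.leadingCoeff) := by
  have h1 : 0 < (p.comp (-X)).natDegree := by simpa [natDegree_comp] using hp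
  obtain ⟨T, hT⟩ := exists_forall_le_sign_eval_eq (p.comp (-X)) h1
  refine ⟨-T, fun x hx => ?_⟩
  have h2 := hT (-x) (by linarith)
  simp only [eval_comp, eval_neg, eval_X, neg_neg] at h2
  rw [h2, comp_neg_X_leadingCoeff_eq]
  rcases Nat.even_or_odd p.natDegree with he | ho
  · simp [he, he.neg_one_pow]
  · simp [ho.neg_one_pow, Nat.not_even_iff_odd.mpr ho, Left.sign_neg]

end Literature.FieldTheory.RealClosed
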